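import Summits.PneNP.PneNP.Theorems.ChebyshevTracialDesignDimensionOne
import HarnessLib

/-!
# Cell pnp-psdrank, route `ChebyshevTracialDesign`: commutative psd strategies of every dimension reduce to
# 0/1 rectangles (the LP shadow inside the SDP crux)

For the crux `TracialDecayExp20` (stmt-PneNP-19878) a psd rectangle of dimension `r` is a pair of families
`0 ⪯ X_U, Y_M ⪯ I_r` with `X_U Y_M = 0` on the tight pairs (`IsPsdRect`), and its value against a weight `W` is
`Σ_{U,M} W(U,M) tr(X_U Y_M)`. We prove:

* §1 ORTHOGONAL INVARIANCE: conjugating both families by one orthogonal matrix `O` preserves `IsPsdRect` and the value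
  (`isPsdRect_conj`, `value_conj`).
* §2 DIAGONAL STRATEGIES ARE MIXTURES OF RECTANGLES: if all `X_U`, `Y_M` are diagonal, the value is the sum over the
  `r` coordinates of the values of `r` fractional tight-free rectangles, each at most the best 0/1 tight-free rectangle
  (the tree's rounding lemma `sum_box_le_rectangle`, p420182); hence `TracialValueLEAt W γ 1` (= "every tight-free 0/1
  rectangle has `W`-mass `≤ γ`", `tracialValueLEAt_one_iff`) gives `value ≤ r·γ` for diagonal strategies of EVERY
  dimension (`value_diagonal_le`), and — by §1 — for every COMMUTATIVE strategy, i.e. one whose `2·#rows·#cols`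
  matrices have a common orthonormal eigenbasis (`value_div_le_of_commonEigenbasis`).
* §3 For the route: the classical `r = 1` shadow of the crux at ANY threshold already implies the crux's inequality for
  all commutative strategies of all dimensions (`commutative_of_dimensionOne`); in particular the dimension budget
  `r²·n < exp(a·dq n)` is idle on the commutative sub-class — the budget (and the open content of the crux) is about
  non-commutativity. This is the "LP ⊂ SDP" sanity statement: a psd factorization with pairwise commuting factors is a
  nonnegative factorization in disguise [cite: Rothvoss2017, §2 (PDF pp. 6–7)], [cite: BrietDadushPokutta2014, Thm. 6 (§3)].

WHAT THIS IS NOT: nothing about non-commutative strategies; the `r = 1` shadow for Chebyshev designs (p1's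
`stub_rung_r1Exp`) is itself open; nothing on general psd rank. Supports crux stmt-PneNP-19878.
-/

set_option linter.dupNamespace false -- `Summit.PneNP.PneNP.…`: summit = sub-problem (D-0017)

noncomputable section

namespace Summit.PneNP.PneNP.Theorems.ChebyshevTracialDesignCommutative

open Finset Matrix Literature.Barriers.PneNP Literature.Combinatorics.Optimization
open Summit.PneNP.PneNP.Theorems.ChebyshevTracialDesignDimensionOne (sum_box_le_rectangle tracialValueLEAt_one_iff)

variable {n : ℕ}

/-! ### §1 Orthogonal conjugation preserves psd rectangles and their values -/

/-- `O A Oᵀ ⪰ 0` for `A ⪰ 0`. -/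
theorem posSemidef_conj {r : ℕ} {A : Matrix (Fin r) (Fin r) ℝ} (hA : A.PosSemidef) (O : Matrix (Fin r) (Fin r) ℝ) :
    (O * A * Oᵀ).PosSemidef := by
  have h := hA.mul_mul_conjTranspose_same O
  rwa [conjTranspose_eq_transpose_of_trivial] at h

/-- `I − O A Oᵀ = O (I − A) Oᵀ` for `O Oᵀ = I`. -/
theorem one_sub_conj {r : ℕ} (A O : Matrix (Fin r) (Fin r) ℝ) (hO : O * Oᵀ = 1) :
    1 - O * A * Oᵀ = O * (1 - A) * Oᵀ := by
  rw [Matrix.mul_sub, Matrix.sub_mul, Matrix.mul_one, hO]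

/-- `(O A Oᵀ)(O B Oᵀ) = O (A B) Oᵀ` for `Oᵀ O = I`. -/
theorem conj_mul_conj {r : ℕ} (A B O : Matrix (Fin r) (Fin r) ℝ) (hO : Oᵀ * O = 1) :
    (O * A * Oᵀ) * (O * B * Oᵀ) = O * (A * B) * Oᵀ := by
  calc (O * A * Oᵀ) * (O * B * Oᵀ) = O * A * (Oᵀ * O) * B * Oᵀ := by simp only [Matrix.mul_assoc]
    _ = O * (A * B) * Oᵀ := by rw [hO, Matrix.mul_one]; simp only [Matrix.mul_assoc]

/-- `tr(O A Oᵀ) = tr(A)` for `Oᵀ O = I`. -/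
theorem trace_conj {r : ℕ} (A O : Matrix (Fin r) (Fin r) ℝ) (hO : Oᵀ * O = 1) : (O * A * Oᵀ).trace = A.trace := by
  rw [trace_mul_cycle, hO, Matrix.one_mul]

/-- **Orthogonal invariance of psd rectangles**: conjugating both families by an orthogonal `O` (`Oᵀ O = I`) gives a
psd rectangle. -/
theorem isPsdRect_conj {r : ℕ} {X : OddSet n → Matrix (Fin r) (Fin r) ℝ} {Y : PMatch n → Matrix (Fin r) (Fin r) ℝ}
    (h : IsPsdRect X Y) (O : Matrix (Fin r) (Fin r) ℝ) (hO : Oᵀ * O = 1) :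
    IsPsdRect (fun U => O * X U * Oᵀ) (fun M => O * Y M * Oᵀ) := by
  have hO' : O * Oᵀ = 1 := mul_eq_one_comm.1 hO
  obtain ⟨hX, hY, hXY⟩ := h
  refine ⟨fun U => ⟨posSemidef_conj (hX U).1 O, ?_⟩, fun M => ⟨posSemidef_conj (hY M).1 O, ?_⟩,
    fun U M hcc => ?_⟩
  · rw [one_sub_conj _ _ hO']; exact posSemidef_conj (hX U).2 O
  · rw [one_sub_conj _ _ hO']; exact posSemidef_conj (hY M).2 O
  · show (O * X U * Oᵀ) * (O * Y M * Oᵀ) = 0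
    rw [conj_mul_conj _ _ _ hO, hXY U M hcc, Matrix.mul_zero, Matrix.zero_mul]

/-- **Orthogonal invariance of the value**. -/
theorem value_conj {r : ℕ} (W : OddSet n → PMatch n → ℝ) (X : OddSet n → Matrix (Fin r) (Fin r) ℝ)
    (Y : PMatch n → Matrix (Fin r) (Fin r) ℝ) (O : Matrix (Fin r) (Fin r) ℝ) (hO : Oᵀ * O = 1) :
    ∑ U, ∑ M, W U M * ((O * X U * Oᵀ) * (O * Y M * Oᵀ)).trace = ∑ U, ∑ M, W U M * (X U * Y M).trace := by
  refine sum_congr rfl fun U _ => sum_congr rfl fun M _ => ?_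
  rw [conj_mul_conj _ _ _ hO, trace_conj _ _ hO]

/-! ### §2 Diagonal strategies are coordinatewise mixtures of fractional rectangles -/

/-- The entries of a DIAGONAL psd rectangle: all in `[0,1]`, and `x_U(i)·y_M(i) = 0` on the tight pairs. -/
theorem entries_of_isPsdRect_diagonal {r : ℕ} {x : OddSet n → Fin r → ℝ} {y : PMatch n → Fin r → ℝ}
    (h : IsPsdRect (fun U => diagonal (x U)) (fun M => diagonal (y M))) :
    (∀ U i, 0 ≤ x U i ∧ x U i ≤ 1) ∧ (∀ M i, 0 ≤ y M i ∧ y M i ≤ 1) ∧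
      ∀ U M, cc U M = 1 → ∀ i, x U i * y M i = 0 := by
  obtain ⟨hX, hY, hXY⟩ := h
  refine ⟨fun U i => ⟨?_, ?_⟩, fun M i => ⟨?_, ?_⟩, fun U M hcc i => ?_⟩
  · exact posSemidef_diagonal_iff.1 (hX U).1 i
  · have h1 := (hX U).2
    rw [← diagonal_one, diagonal_sub] at h1
    have := posSemidef_diagonal_iff.1 h1 i
    linarith
  · exact posSemidef_diagonal_iff.1 (hY M).1 i
  · have h1 := (hY M).2
    rw [← diagonal_one, diagonal_sub] at h1
    have := posSemidef_diagonal_iff.1 h1 i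
    linarith
  · have h0 : diagonal (x U) * diagonal (y M) = 0 := hXY U M hcc
    rw [diagonal_mul_diagonal] at h0
    have := congrFun (congrFun h0 i) i
    rwa [diagonal_apply_eq, Matrix.zero_apply] at this

/-- The value of a diagonal strategy is the sum over coordinates of the values of its coordinate rectangles. -/
theorem value_diagonal_eq {r : ℕ} (W : OddSet n → PMatch n → ℝ) (x : OddSet n → Fin r → ℝ)
    (y : PMatch n → Fin r → ℝ) :
    ∑ U, ∑ M, W U M * (diagonal (x U) * diagonal (y M)).trace = ∑ i : Fin r, ∑ U, ∑ M, W U M * (x U i * y M i) := by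
  simp only [diagonal_mul_diagonal, trace_diagonal, mul_sum]
  calc ∑ U, ∑ M, ∑ i, W U M * (x U i * y M i) = ∑ U, ∑ i, ∑ M, W U M * (x U i * y M i) :=
        sum_congr rfl fun U _ => sum_comm
    _ = ∑ i, ∑ U, ∑ M, W U M * (x U i * y M i) := sum_comm

/-- **Diagonal strategies of every dimension obey the `r = 1` bound**: if every tight-free 0/1 rectangle has `W`-mass
`≤ γ` (`TracialValueLEAt W γ 1`), then every diagonal psd rectangle of dimension `r` has value `≤ r·γ`. -/
theorem value_diagonal_le {r : ℕ} (W : OddSet n → PMatch n → ℝ) (γ : ℝ) (h1 : TracialValueLEAt W γ 1)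
    {x : OddSet n → Fin r → ℝ} {y : PMatch n → Fin r → ℝ}
    (h : IsPsdRect (fun U => diagonal (x U)) (fun M => diagonal (y M))) :
    ∑ U, ∑ M, W U M * (diagonal (x U) * diagonal (y M)).trace ≤ r * γ := by
  obtain ⟨hx, hy, hxy⟩ := entries_of_isPsdRect_diagonal h
  have hrect := (tracialValueLEAt_one_iff W γ).1 h1
  rw [value_diagonal_eq]
  calc ∑ i, ∑ U, ∑ M, W U M * (x U i * y M i) ≤ ∑ _i : Fin r, γ := sum_le_sum fun i _ => by
        obtain ⟨A, B, hAB, hle⟩ := sum_box_le_rectangle W (fun U M => cc U M = 1) (fun U => x U i)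
          (fun M => y M i) (fun U => hx U i) (fun M => hy M i) (fun U M hcc => hxy U M hcc i)
        exact hle.trans (hrect A B fun U hU M hM => hAB U hU M hM)
    _ = r * γ := by rw [sum_const, card_univ, Fintype.card_fin, nsmul_eq_mul]

/-- **Commutative strategies of every dimension obey the `r = 1` bound.** If the `X_U` and `Y_M` have a common
orthonormal eigenbasis — the columns of an orthogonal `O`, i.e. `X_U = O·diag(x_U)·Oᵀ`, `Y_M = O·diag(y_M)·Oᵀ`
(equivalently: the finitely many symmetric matrices `X_U`, `Y_M` pairwise commute) — then `TracialValueLEAt W γ 1`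
gives `value / r ≤ γ`, whatever `r ≥ 1`. -/
theorem value_div_le_of_commonEigenbasis {r : ℕ} (hr : 0 < r) (W : OddSet n → PMatch n → ℝ) (γ : ℝ)
    (h1 : TracialValueLEAt W γ 1) (O : Matrix (Fin r) (Fin r) ℝ) (hO : Oᵀ * O = 1)
    (x : OddSet n → Fin r → ℝ) (y : PMatch n → Fin r → ℝ)
    {X : OddSet n → Matrix (Fin r) (Fin r) ℝ} {Y : PMatch n → Matrix (Fin r) (Fin r) ℝ}
    (hX : ∀ U, X U = O * diagonal (x U) * Oᵀ) (hY : ∀ M, Y M = O * diagonal (y M) * Oᵀ) (h : IsPsdRect X Y) :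
    (∑ U, ∑ M, W U M * (X U * Y M).trace) / r ≤ γ := by
  have hO' : O * Oᵀ = 1 := mul_eq_one_comm.1 hO
  -- conjugating back by `Oᵀ` gives the diagonal strategy
  have hOt : (Oᵀ)ᵀ * Oᵀ = 1 := by rw [transpose_transpose, hO']
  have hdiag := isPsdRect_conj h Oᵀ hOt
  have hXd : ∀ U, Oᵀ * X U * (Oᵀ)ᵀ = diagonal (x U) := fun U => by
    rw [hX U, transpose_transpose]
    calc Oᵀ * (O * diagonal (x U) * Oᵀ) * O = (Oᵀ * O) * diagonal (x U) * (Oᵀ * O) := by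
          simp only [Matrix.mul_assoc]
      _ = diagonal (x U) := by rw [hO, Matrix.one_mul, Matrix.mul_one]
  have hYd : ∀ M, Oᵀ * Y M * (Oᵀ)ᵀ = diagonal (y M) := fun M => by
    rw [hY M, transpose_transpose]
    calc Oᵀ * (O * diagonal (y M) * Oᵀ) * O = (Oᵀ * O) * diagonal (y M) * (Oᵀ * O) := by
          simp only [Matrix.mul_assoc]
      _ = diagonal (y M) := by rw [hO, Matrix.one_mul, Matrix.mul_one]
  have hdiag' : IsPsdRect (fun U => diagonal (x U)) (fun M => diagonal (y M)) := by
    have e1 : (fun U => Oᵀ * X U * (Oᵀ)ᵀ) = fun U => diagonal (x U) := funext hXd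
    have e2 : (fun M => Oᵀ * Y M * (Oᵀ)ᵀ) = fun M => diagonal (y M) := funext hYd
    rw [← e1, ← e2]; exact hdiag
  have hval : ∑ U, ∑ M, W U M * (X U * Y M).trace = ∑ U, ∑ M, W U M * (diagonal (x U) * diagonal (y M)).trace := by
    rw [← value_conj W X Y Oᵀ hOt]
    refine sum_congr rfl fun U _ => sum_congr rfl fun M _ => ?_
    rw [hXd U, hYd M]
  rw [hval, div_le_iff₀ (by exact_mod_cast hr : (0 : ℝ) < r)]
  calc ∑ U, ∑ M, W U M * (diagonal (x U) * diagonal (y M)).trace ≤ r * γ := value_diagonal_le W γ h1 hdiag'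
    _ = γ * r := mul_comm _ _

/-! ### §3 For the route: the `r = 1` shadow governs every commutative strategy, with no dimension budget -/

/-- **The `r = 1` shadow of the crux implies the crux for commutative strategies of every dimension.** If, for a
design `(t, C, w)`, every tight-free 0/1 rectangle has design mass `≤ γ` (the rectangle statement
`TracialValueLEAt (levelWeight n t C w) γ 1`), then every commutative psd rectangle of every dimension `r ≥ 1` has
normalised value `≤ γ` — no condition `r²·n < exp(a·dq n)` is needed on this sub-class. -/
theorem commutative_of_dimensionOne {t r : ℕ} (hr : 0 < r) (C : Finset ℕ) (w : ℕ → ℝ) (γ : ℝ)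
    (h1 : TracialValueLEAt (levelWeight n t C w) γ 1) (O : Matrix (Fin r) (Fin r) ℝ) (hO : Oᵀ * O = 1)
    (x : OddSet n → Fin r → ℝ) (y : PMatch n → Fin r → ℝ)
    {X : OddSet n → Matrix (Fin r) (Fin r) ℝ} {Y : PMatch n → Matrix (Fin r) (Fin r) ℝ}
    (hX : ∀ U, X U = O * diagonal (x U) * Oᵀ) (hY : ∀ M, Y M = O * diagonal (y M) * Oᵀ) (h : IsPsdRect X Y) :
    (∑ U, ∑ M, levelWeight n t C w U M * (X U * Y M).trace) / r ≤ γ :=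
  value_div_le_of_commonEigenbasis hr (levelWeight n t C w) γ h1 O hO x y hX hY h

end Summit.PneNP.PneNP.Theorems.ChebyshevTracialDesignCommutative

end
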